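import Summits.BirchSwinnertonDyer.Rank1Residual.X11a.SelmerCompanionSplitAtPShape
import Summits.BirchSwinnertonDyer.Rank1Residual.X11a.SelmerCompanionRoute
import Literature.NumberTheory.EllipticCurves.KummerMap
import HarnessLib

/-!
# Route (3e) SELMER COMPANION, XXI: the strictness-at-`p` certificate of a closed rank-one partner,
# in the kernel (class X11a = N7; cell `b2b-bsdres`, unit `b2b-bsdres-x11a`, gen 29)

HONEST FRAMING (run/shared/lean/b2b/bsd-rank1-residual/, verbatim in every file): the goal of the
cell is to DELETE the COMBINATION-SHAPED residual classes of the Birch–Swinnerton-Dyer formula for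
ALL analytic-rank `≤ 1` elliptic curves over `ℚ` — "full BSD formula for every rank `≤ 1` curve in
class `C`" assembled STRICTLY from published theorems — so that the rank-`≤ 1` remainder becomes
exactly the CONSTRUCTION-SHAPED classes, which are TYPED (missing-input `Prop`s), NOT attempted.
This is not "finishing BSD". CLASS-OWNERS.md: research routes; NO CLAIM BEYOND STATED CLASSES.
THEOREMS ONLY; nothing booked; no label moves. CONDITIONAL on the PUBLISHED binders GZK (`hGZK`),
Cassels–Tate (`hCT`), Tate uniformisation (`hU` = A40, `hU2` = A41), Tate's local Euler
characteristic (`hEP`, Milne *ADT* I Thm. 2.8), and on the per-pair finite data named.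

## What this file proves

Files XIX/XX remove the factor `#Sel^(p)(A)` from the count of route (3e) at the place `p` under
the hypothesis `hstrict`: no non-zero class of `Sel^(p)(A/ℚ)` is, over `Γ_{ℚ_p}`, the coboundary of
a point `b ∈ A(K̄_p)` with `σb − b` in the kernel of reduction `A₁` for all `σ`. The census certifies
it for a CLOSED rank-one partner by the finite check `g̃ ∉ p·Ã(𝔽_p)` on Cremona's generator `g`.
This file puts the link in the kernel (`strict_at_p_of_kummerClass`): **if `#Sel^(p)(A/ℚ) = p` and
`Sel^(p)(A)` contains the Kummer class of a point `Q ∈ A(ℚ̄)` (`pQ = g` rational) such that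
NO `p`-th root `c ∈ A(K̄_p)` of `g` is rational modulo `A₁` (`hcert`: for every `c` with `pc = g` some
`σ ∈ Γ_{ℚ_p}` has `σc − c ∉ A₁`; equivalently `g̃ ∉ p·Ã(𝔽_p)`), then `hstrict` holds.** PROOF: a
non-zero Selmer class `[ψ]` with `ψ|_{Γ_p} = ∂b`, `∂b ⊆ A₁`, generates `Sel^(p)(A) ≅ ℤ/p`, so
`κ(Q) = k[ψ]`; on cocycles `kψ − (σ ↦ σQ − Q) = ∂T` with `T ∈ A[p]`; over `Γ_{ℚ_p}` this reads
`σ(Q + T) − (Q + T) = k(σb − b) ∈ A₁`, and `c = Q + T` has `pc = pQ = g` — contradicting `hcert`.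
Corollary (`bsdp_of_bsdp_partner_of_generator_certificate_at_p`): the booking shape of file XX with
`hstrict` replaced by its certificate — `BSD(A,p)` (closed partner), `r_an(A) = 1`, `p ∤ #Ш_an(A)`,
`A[p]` irreducible (so `#Sel^(p)(A) = p`, file II), a rational point `g` of `A` and `hcert` for `g`
(which forces `κ(g) ≠ 0`). What remains OUTSIDE the kernel is only the reading of `hcert` as the
residue-field computation `(m/p)·g̃ ≠ O`, `m = #Ã(𝔽_p)` (Hensel lifting of `𝔽_p`-points).

References: files II, XIX, XX; [SilvermanAEC2009] VIII.§2, X.§4; [MazurRubin2004] §2.3;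
HOME/b2b-bsdres-x11a/REPORT-g29.md.
-/

set_option autoImplicit false

noncomputable section

open scoped Classical NNReal

open WeierstrassCurve Literature.NumberTheory.EllipticCurves
  Literature.NumberTheory.GaloisRepresentations Field NumberField IsDedekindDomain
  IsDedekindDomain.HeightOneSpectrum Literature.NumberTheory.EllipticCurves.FormalGroupChart
  Literature.NumberTheory.EllipticCurves.Rank1Residual
  Literature.NumberTheory.EllipticCurves.Rank1Residual.Typed

namespace Summit.BirchSwinnertonDyer.Rank1Residual.X11a.SelmerCompanion

variable (A : WeierstrassCurve ℚ) [A.IsElliptic] (p : ℕ) [hp : Fact p.Prime]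
  {v : HeightOneSpectrum (𝓞 ℚ)}
  {w : Valuation (AlgebraicClosure (v.adicCompletion ℚ)) ℝ≥0}

omit [A.IsElliptic] in
/-- **The strictness-at-`p` certificate in the kernel.** Let `#Sel^(p)(A/ℚ) = p` and let
`Sel^(p)(A)` contain the Kummer class of a point `Q ∈ A(ℚ̄)` with `pQ` rational. If no
`p`-th root `c ∈ A(K̄_v)` of the image of `pQ` is rational modulo the kernel of reduction (`hcert`:
for every `c` with `p c = pQ` some `σ ∈ Γ_{ℚ_v}` moves `c` by an element outside `A₁(K̄_v)`), then
every class of `Sel^(p)(A)` which over `Γ_{ℚ_v}` is the coboundary of a point `b` with `σb − b ∈ A₁`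
for all `σ` is ZERO (the hypothesis `hstrict` of files XIX/XX). See the module docstring for the
five-line proof (a group of prime order is generated by any non-zero element; `hcert` forces the
Kummer class of `Q` to be non-zero, so no separate hypothesis `κ(Q) ≠ 0` is needed).
[cite: SilvermanAEC2009, VIII.§2 and X.§4 diagram (**)] [cite: MazurRubin2004, §2.3] -/
theorem strict_at_p_of_kummerClass
    [hV : (A.baseChange (AlgebraicClosure (v.adicCompletion ℚ))).IsIntegral w.integer]
    (hSel : Nat.card (A.selmerGroup (p : ℤ)) = p)
    {Q : geomPoints A}
    (hQ : (p : ℤ) • Q ∈ MulAction.fixedPoints (absoluteGaloisGroup ℚ) (geomPoints A))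
    (hs : kummerClassTorsion A (p : ℤ) Q hQ ∈ A.selmerGroup (p : ℤ))
    (hcert : ∀ c : localPoints A (v.adicCompletion ℚ),
      (p : ℤ) • c = pointsMap A (v.adicCompletion ℚ) ((p : ℤ) • Q) →
      ∃ σ : absoluteGaloisGroup (v.adicCompletion ℚ),
        ((σ • c - c : localPoints A (v.adicCompletion ℚ)) :
          (A.baseChange (AlgebraicClosure (v.adicCompletion ℚ))).toAffine.Point) ∉
          kernel w (A.baseChange (AlgebraicClosure (v.adicCompletion ℚ))))
    (ψ : contOneCocycles (discreteTopRep (absoluteGaloisGroup ℚ) (geomTorsion A (p : ℤ))))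
    (hψ : oneCocycleClass _ ψ ∈ A.selmerGroup (p : ℤ))
    (b : localPoints A (v.adicCompletion ℚ))
    (hb : ∀ σ : absoluteGaloisGroup (v.adicCompletion ℚ), pointsMap A (v.adicCompletion ℚ)
      ((ψ.1 (resGal (K := ℚ) (v.adicCompletion ℚ) σ) : geomTorsion A (p : ℤ)) : geomPoints A)
        = σ • b - b)
    (hbk : ∀ σ : absoluteGaloisGroup (v.adicCompletion ℚ),
      ((σ • b - b : localPoints A (v.adicCompletion ℚ)) :
        (A.baseChange (AlgebraicClosure (v.adicCompletion ℚ))).toAffine.Point) ∈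
        kernel w (A.baseChange (AlgebraicClosure (v.adicCompletion ℚ)))) :
    oneCocycleClass _ ψ = 0 := by
  by_contra h0
  haveI : Finite (A.selmerGroup (p : ℤ)) :=
    Nat.finite_of_card_ne_zero (by rw [hSel]; exact hp.out.ne_zero)
  -- `κ(Q) = k [ψ]` in the group `Sel^(p)(A)` of prime order
  obtain ⟨k, hk⟩ := OrdinaryLine.exists_zsmul_eq_of_card_prime (p := p) (A.selmerGroup (p : ℤ)) hSel
    hψ h0 hs
  -- on cocycles: `k ψ - κ_Q = ∂T`, `T ∈ A[p]`
  have hcl : oneCocycleClass _ (k • ψ - kummerCocycleTorsion A (p : ℤ) Q hQ) = 0 := by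
    rw [oneCocycleClass_sub, ← oneCocycleClassₗ_apply, map_zsmul, oneCocycleClassₗ_apply, hk]
    exact sub_eq_zero.mpr rfl
  obtain ⟨T, hT⟩ := (oneCocycleClass_eq_zero_iff _ _).mp hcl
  have hTσ : ∀ σ : absoluteGaloisGroup ℚ,
      k • ((ψ.1 σ : geomTorsion A (p : ℤ)) : geomPoints A) - (σ • Q - Q) =
        σ • ((T : geomTorsion A (p : ℤ)) : geomPoints A) - T := by
    intro σ
    have h1 := hT σ
    rw [discreteTopRep_ρ_apply] at h1
    have h2 := congrArg (fun x : geomTorsion A (p : ℤ) ↦ (x : geomPoints A)) h1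
    change (((k • ψ.1 σ - (kummerCocycleTorsion A (p : ℤ) Q hQ).1 σ : geomTorsion A (p : ℤ)) :
        geomPoints A)) = ((σ • T - T : geomTorsion A (p : ℤ)) : geomPoints A) at h2
    rwa [AddSubgroupClass.coe_sub, AddSubgroupClass.coe_zsmul, coe_kummerCocycleTorsion_apply,
      AddSubgroupClass.coe_sub,
      Literature.NumberTheory.EllipticCurves.AddSubgroup.torsionBy.coe_smul] at h2
  -- over `Γ_{ℚ_v}`: `c = Q + T` has `p c = p Q` and `σ c - c = k (σ b - b) ∈ A₁`
  have hT'p : (p : ℤ) • pointsMap A (v.adicCompletion ℚ) ((T : geomTorsion A (p : ℤ)) : geomPoints A)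
      = 0 := by
    rw [← map_zsmul, (mem_geomTorsion_iff A _ _).mp T.2, map_zero]
  have hloc : ∀ σ : absoluteGaloisGroup (v.adicCompletion ℚ),
      σ • (pointsMap A (v.adicCompletion ℚ) Q +
          pointsMap A (v.adicCompletion ℚ) ((T : geomTorsion A (p : ℤ)) : geomPoints A)) -
        (pointsMap A (v.adicCompletion ℚ) Q +
          pointsMap A (v.adicCompletion ℚ) ((T : geomTorsion A (p : ℤ)) : geomPoints A)) =
        k • (σ • b - b) := by
    intro σ
    have h := congrArg (pointsMap A (v.adicCompletion ℚ))
      (hTσ (resGal (K := ℚ) (v.adicCompletion ℚ) σ))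
    rw [map_sub, map_zsmul, hb σ, map_sub, pointsMap_smul, map_sub, pointsMap_smul,
      sub_eq_iff_eq_add] at h
    rw [h, smul_add]
    abel
  obtain ⟨σ₀, hσ₀⟩ := hcert (pointsMap A (v.adicCompletion ℚ) Q +
      pointsMap A (v.adicCompletion ℚ) ((T : geomTorsion A (p : ℤ)) : geomPoints A))
    (by rw [smul_add, hT'p, add_zero, map_zsmul])
  have hmem : ((k • (σ₀ • b - b) : localPoints A (v.adicCompletion ℚ)) :
      (A.baseChange (AlgebraicClosure (v.adicCompletion ℚ))).toAffine.Point) ∈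
      kernel w (A.baseChange (AlgebraicClosure (v.adicCompletion ℚ))) :=
    (kernel w (A.baseChange (AlgebraicClosure (v.adicCompletion ℚ)))).zsmul_mem (hbk σ₀) k
  rw [← hloc σ₀] at hmem
  exact hσ₀ hmem

variable (W : WeierstrassCurve ℚ) [W.IsElliptic] [W.IsGloballyMinimal] [A.IsGloballyMinimal]

/-- **Shape E with the generator certificate — `BSD(A,p) ⟹ BSD(E,p)` at a split-at-`p` cell with
an anomalous good rank-one partner.** As `bsdp_of_selmerCompanion_strict_at_p_six_kinds` (file
XX), with the strictness hypothesis `hstrict` REPLACED by its certificate: the partner `A` is CLOSED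
at `p` (`BSD(A,p)`), of analytic rank `1`, with `p ∤ #Ш_an(A)` and `A[p]` irreducible — so
`#Sel^(p)(A/ℚ) = p` (file II `natCard_selmerGroup_eq_pow_of_bsdp`) — and `g ∈ A(ℚ)` is a rational
point NO `p`-th root of which in `A(K̄_p)` is rational modulo the kernel of reduction (`hcert`; for
Cremona's generator this is the finite check `(m/p)·g̃ ≠ O in Ã(𝔽_p)`). The Kummer class `κ(g)`
(tree `kummerMapTorsion`, divisibility of `A(ℚ̄)` by the tree theorem
`zsmul_geomPoints_surjective_of_charZero`) lies in `Sel^(p)(A)` (`kummerMapTorsion_mem_selmerLocalKer`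
at every place), and `strict_at_p_of_kummerClass` supplies `hstrict`. Binders GZK, Cassels–Tate,
A40/A41, Milne I.2.8; inputs BSD(A,p), C1 (`e`), the place data, the certificate. Not a class
theorem; nothing booked. [cite: Miller2011LMS, §1 and Def. 1.1] [cite: MazurRubin2004, §2.3]
[cite: SilvermanAEC2009, VIII.§2, X.§4 diagram (**), Thm X.4.2]
[cite: SilvermanATAEC1994, Ch. V Thm. 3.1, Lemma 5.2, Thm. 5.3, Cor. 5.4, Ex. 5.11]
[cite: GreenbergLNM1716, §2 Props. 2.2, 2.4] [cite: MilneADT2006, Ch. I §2 Thm. 2.8, Prop. 3.8] -/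
theorem bsdp_of_bsdp_partner_of_generator_certificate_at_p
    (hU : Silverman1994_thmV53_tateUniformisation.{0})
    (hU2 : Silverman1994_thmV53_corV54_tateUniformisation.{0})
    (hEP : ∀ v : HeightOneSpectrum (𝓞 ℚ), (p : 𝓞 ℚ) ∈ v.asIdeal →
      localEulerPoincareCharacteristic (v.adicCompletion ℚ))
    (hGZK : rank_eq_analyticRank_of_analyticRank_le_one)
    (hCT : exists_casselsTate_pairing (K := ℚ)) (hp2 : p ≠ 2)
    (hr : W.analyticRank = 0) (hirr : Irr W p) (hSha : X11a.ShaAnUnit W p)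
    (hbsdA : BSDp A p) (hrA : A.analyticRank = 1) (hirrA : Irr A p) (hShaA : X11a.ShaAnUnit A p)
    (e : geomTorsion A (p : ℤ) ≃+ geomTorsion W (p : ℤ))
    (he : ∀ (σ : absoluteGaloisGroup ℚ) (P : geomTorsion A (p : ℤ)), e (σ • P) = σ • e P)
    (S T : Finset (HeightOneSpectrum (𝓞 ℚ))) (hTS : T ⊆ S)
    (hS : ∀ v : HeightOneSpectrum (𝓞 ℚ), v ∉ S →
      A.HasGoodReductionAt v ∧ W.HasGoodReductionAt v ∧ (p : 𝓞 ℚ) ∉ v.asIdeal)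
    {v₀ : HeightOneSpectrum (𝓞 ℚ)} (hpv₀ : (p : 𝓞 ℚ) ∈ v₀.asIdeal) (hv₀S : v₀ ∈ S) (hv₀T : v₀ ∉ T)
    (hmult : W.HasMultiplicativeReductionAtPrime p) (hA₀ : A.HasGoodReductionAtPrime p)
    (hplaces : ∀ v ∈ S, v ∉ T → v ≠ v₀ →
      ((p : 𝓞 ℚ) ∉ v.asIdeal ∧ Nat.card (nsmulAddMonoidHom p :
          (W.baseChange (v.adicCompletion ℚ)).toAffine.Point →+ _).ker = 1) ∨
      (A.HasSplitMultiplicativeReductionAt v ∧ W.HasSplitMultiplicativeReductionAt v ∧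
        Nat.card (nsmulAddMonoidHom p :
          (A.baseChange (v.adicCompletion ℚ)).toAffine.Point →+ _).ker ≤ p) ∨
      (A.HasMultiplicativeReductionAt v ∧ W.HasMultiplicativeReductionAt v ∧
        (∃ r : v.adicCompletion ℚ, algebraMap ℚ (v.adicCompletion ℚ) (-(A.c₄ / A.c₆)) =
          r ^ 2 * algebraMap ℚ (v.adicCompletion ℚ) (-(W.c₄ / W.c₆))) ∧
        (∀ ζ : v.adicCompletion ℚ, ζ ^ p = 1 → ζ = 1)) ∨
      (∃ (ℓ : ℕ) (_ : Fact ℓ.Prime), ℓ ≠ 2 ∧ (ℓ : 𝓞 ℚ) ∈ v.asIdeal ∧ (p : 𝓞 ℚ) ∉ v.asIdeal ∧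
        W.HasMultiplicativeReductionAtPrime ℓ ∧
        (∀ r : v.adicCompletion ℚ, algebraMap ℚ (v.adicCompletion ℚ) (-(W.c₄ / W.c₆)) ≠ r ^ 2) ∧
        A.HasGoodReductionAt v) ∨
      ((p : 𝓞 ℚ) ∈ v.asIdeal ∧ W.HasMultiplicativeReductionAtPrime p ∧
        (∀ r : v.adicCompletion ℚ, algebraMap ℚ (v.adicCompletion ℚ) (-(W.c₄ / W.c₆)) ≠ r ^ 2) ∧
        A.HasGoodReductionAtPrime p) ∨
      (∃ (ℓ : ℕ) (_ : Fact ℓ.Prime), ℓ ≠ 2 ∧ (ℓ : 𝓞 ℚ) ∈ v.asIdeal ∧ (p : 𝓞 ℚ) ∉ v.asIdeal ∧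
        W.HasGoodReductionAt v ∧ A.HasMultiplicativeReductionAtPrime ℓ ∧
        (∀ r : v.adicCompletion ℚ, algebraMap ℚ (v.adicCompletion ℚ) (-(A.c₄ / A.c₆)) ≠ r ^ 2)))
    {w : Valuation (AlgebraicClosure (v₀.adicCompletion ℚ)) ℝ≥0}
    (hw : ∀ x, (w x : ℝ) =
      spectralNorm (v₀.adicCompletion ℚ) (AlgebraicClosure (v₀.adicCompletion ℚ)) x)
    [hV : (A.baseChange (AlgebraicClosure (v₀.adicCompletion ℚ))).IsIntegral w.integer]
    (g : A.toAffine.Point)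
    (hcert : ∀ c : localPoints A (v₀.adicCompletion ℚ),
      (p : ℤ) • c = pointsMap A (v₀.adicCompletion ℚ) (toGeomPoints A g) →
      ∃ σ : absoluteGaloisGroup (v₀.adicCompletion ℚ),
        ((σ • c - c : localPoints A (v₀.adicCompletion ℚ)) :
          (A.baseChange (AlgebraicClosure (v₀.adicCompletion ℚ))).toAffine.Point) ∉
          kernel w (A.baseChange (AlgebraicClosure (v₀.adicCompletion ℚ))))
    (hbudget : p * ∏ v ∈ T, (Nat.card (nsmulAddMonoidHom p :
        (W.baseChange (v.adicCompletion ℚ)).toAffine.Point →+ _).ker *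
          Nat.card (v.adicCompletionIntegers ℚ ⧸
            Ideal.span {(p : v.adicCompletionIntegers ℚ)})) ≤ p) :
    BSDp W p := by
  have hpp : p.Prime := hp.out
  have hn : (p : ℤ) ≠ 0 := by exact_mod_cast hpp.ne_zero
  -- `#Sel^(p)(A) = p` for the closed rank-one partner
  have hSel : Nat.card (A.selmerGroup (p : ℤ)) = p := by
    rw [natCard_selmerGroup_eq_pow_of_bsdp A p hbsdA hShaA hirrA, hrA, pow_one]
  -- the Kummer class of a `p`-th root `Q` of `g` lies in `Sel^(p)(A)`
  have hdiv : ∀ P : geomPoints A, ∃ Q : geomPoints A, (p : ℤ) • Q = P :=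
    fun P ↦ A.zsmul_geomPoints_surjective_of_charZero hn P
  have hs : kummerClassTorsion A (p : ℤ) (zsmulRoot A (p : ℤ) hdiv g)
      (zsmul_zsmulRoot_mem A (p : ℤ) hdiv g) ∈ A.selmerGroup (p : ℤ) := by
    have h : kummerMapTorsion A (p : ℤ) hdiv g ∈ A.selmerGroup (p : ℤ) :=
      (mem_selmerGroup_iff A _ _).mpr
        ⟨fun v ↦ kummerMapTorsion_mem_selmerLocalKer A (p : ℤ) hdiv (v.adicCompletion ℚ) g,
          fun w' ↦ kummerMapTorsion_mem_selmerLocalKer A (p : ℤ) hdiv w'.Completion g⟩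
    rw [kummerMapTorsion_apply] at h
    exact h
  have hθ : ∀ (σ : absoluteGaloisGroup ℚ) (Q : geomTorsion W (p : ℤ)),
      e.symm (σ • Q) = σ • e.symm Q := fun σ Q ↦ by
    apply e.injective
    rw [e.apply_symm_apply, he, e.apply_symm_apply]
  have hle := natCard_selmerGroup_le_of_six_kinds_strict_at_p_rat W A p hU hU2 hEP hp2 e.symm hθ
    S T hTS hS hpv₀ hv₀S hv₀T hmult hA₀ hplaces hw
    (fun ψ hψ b hb hbk ↦ strict_at_p_of_kummerClass A p hSel (zsmul_zsmulRoot_mem A (p : ℤ) hdiv g)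
      hs (fun c hc ↦ hcert c (by rw [hc, zsmul_zsmulRoot])) ψ hψ b hb hbk)
  exact bsdp_of_natCard_selmerGroup_le W p hGZK hCT hr hirr hSha (hle.trans hbudget)

end Summit.BirchSwinnertonDyer.Rank1Residual.X11a.SelmerCompanion

end
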